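import Mathlib
import HarnessLib
import Summits.HubbardSuperconductivity.HubbardSuperconductivity.Theorems.WeakCouplingBCSKlLindhardKernelL4
import Summits.HubbardSuperconductivity.HubbardSuperconductivity.Theorems.WeakCouplingBCSKlThirdOrderFormBoundOfHS
import Literature.MathematicalPhysics.QuantumLattice.KohnLuttingerKernelPolarL2

/-!
# WeakCouplingBCS — KL certificate: the chain-kernel Hilbert–Schmidt slot holds UNIFORMLY on every window `[a, b] ⊆ (−4, 0)`

Quantitative, window-uniform form of `…KlLindhardKernelL4` (✓): the constants of the `L⁴` route are uniform on compact windows — (TSL) and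
(SV) by ✓ `exists_torusSublevel_le` / `exists_shellVolume_le` on `[a, b]`, and the density of states by compactness
(`kl4w_exists_fermiPolarDOS_le_window`, from ✓ `continuousOn_fermiPolarDOS_uncurry` + `2π`-periodicity) — so the `L⁴(σ_μ ⊗ σ_μ)` norm of
`χ₀(k + k')` and hence the `L²(σ_μ ⊗ σ_μ)` norm of the chain kernel `χ₀(k−k')² + χ₀(k+k')²` are bounded by ONE constant for all `μ ∈ [a, b]`:

* §1 `kl4w_exists_fermiPolarDOS_le_window` — `∃ w₁ ≥ 0, ∀ μ ∈ [a,b], ∀ θ, fermiPolarDOS μ θ ≤ w₁`;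
* §2 `kl4w_lintegral_eLpNorm_polar_le` / `kl4w_eLpNorm_lindhardKernelPolar_le` — the Minkowski bound with explicit (uniform) right-hand side;
* §3 `kl4w_eLpNorm_kernel_le` — transport: `‖χ₀(·+·)‖_{L⁴(σ_μ⊗σ_μ)} ≤ (w₁²)^{1/4} · ‖polar kernel‖_{L⁴(dθdθ')}`;
* §4 `kl4_exists_chainHS` (`∃ H ≥ 0, ChainHS 0 μ μ H` at one level), `kl4_formBound_of_twoLoopHS`, `kl4_channelRemainderBound_of_twoLoopHS`;
* §5 **`kl4w_exists_chainHS_window`** — `−4 < a → b < 0 → ∃ H ≥ 0, KlThirdOrder.ChainHS 0 a b H`; hence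
  **`kl4w_formBound_window_of_twoLoopHS`** (`∃ H ≥ 0, ∀ T, TwoLoopHS 0 a b T → FormBound 0 a b (H + T)`) and, on the doping window
  `δ ∈ [0.10, 0.20]`, **`kl4w_channelInf3_B1g_lt_window_d010_d020_of_twoLoopHS`**: third-order `B1g` selection below `klU0 (437/16384) (H + T) 1`
  from the three records' `EnclosuresB1g` (RECORD) and a two-loop HS enclosure `T` ALONE (the chain half is now a theorem).

Honest framing: qualitative (existential `H`, no number); the two-loop kernel stays a hypothesis; register expectation 0.00; not ODLRO; nothing
here proves superconductivity in the Hubbard model.  Filed `--supports stmt-HubbardSuperconductivity-0158`.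

References: E. M. Stein, *Singular Integrals and Differentiability Properties of Functions* (1970), App. A.1; S. Raghu, S. A. Kivelson,
D. J. Scalapino, Phys. Rev. B 81 (2010) 224505, App. A.
-/

noncomputable section

-- the tree's namespace `Summit.<Summit>.<Problem>.Theorems` repeats the summit name by design (D-0017)
set_option linter.dupNamespace false

namespace Summit.HubbardSuperconductivity.HubbardSuperconductivity.Theorems

open Real Set Filter MeasureTheory MeasureTheory.Measure Literature.MathematicalPhysics.QuantumLattice CwKLChiralWindow KlThirdOrder
open scoped Topology ENNReal NNReal

/-! ### §1 A window-uniform bound of the density of states -/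

/-- The density of states `(μ, θ) ↦ fermiPolarDOS μ θ` attains its maximum on the compact rectangle `[a, b] × [−π, π]` (`[a, b] ⊆ (−4, 0)`,
`a ≤ b`; joint continuity ✓ `continuousOn_fermiPolarDOS_uncurry`). [folklore] -/
theorem kl4w_exists_isMaxOn_fermiPolarDOS {a b : ℝ} (ha : -4 < a) (hb : b < 0) (hab : a ≤ b) :
    ∃ p₀ ∈ Icc a b ×ˢ Icc (-π) π, IsMaxOn (fun p : ℝ × ℝ => fermiPolarDOS p.1 p.2) (Icc a b ×ˢ Icc (-π) π) p₀ := by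
  have hKc : IsCompact (Icc a b ×ˢ Icc (-π) π) := isCompact_Icc.prod isCompact_Icc
  have hKne : (Icc a b ×ˢ Icc (-π) π).Nonempty :=
    ⟨(a, 0), Set.mk_mem_prod ⟨le_rfl, hab⟩ ⟨by linarith [Real.pi_pos], by linarith [Real.pi_pos]⟩⟩
  have hsub : Icc a b ×ˢ Icc (-π) π ⊆ Ioo (-4 : ℝ) 0 ×ˢ (univ : Set ℝ) :=
    Set.prod_mono (fun μ hμ => ⟨lt_of_lt_of_le ha hμ.1, lt_of_le_of_lt hμ.2 hb⟩) (Set.subset_univ _)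
  have hcont : ContinuousOn (fun p : ℝ × ℝ => fermiPolarDOS p.1 p.2) (Icc a b ×ˢ Icc (-π) π) :=
    continuousOn_fermiPolarDOS_uncurry.mono hsub
  exact hKc.exists_isMaxOn hKne hcont

/-- Reduction of the angle to the period `(−π, π]` (`2π`-periodicity of the density of states, ✓ `fermiPolarDOS_add_int_mul_two_pi`). [folklore] -/
theorem kl4w_fermiPolarDOS_reduce_period {a b : ℝ} (ha : -4 < a) (hb : b < 0) {μ : ℝ} (hμ : μ ∈ Icc a b) (θ : ℝ) :
    ∃ θ' ∈ Icc (-π) π, fermiPolarDOS μ θ = fermiPolarDOS μ θ' := by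
  have hμ1 : -4 < μ := lt_of_lt_of_le ha hμ.1
  have hμ2 : μ < 0 := lt_of_le_of_lt hμ.2 hb
  set θ' := toIocMod Real.two_pi_pos (-π) θ with hθ'
  have hmem : θ' ∈ Icc (-π) π := by
    have h := toIocMod_mem_Ioc Real.two_pi_pos (-π) θ
    rw [← hθ'] at h
    exact ⟨h.1.le, by linarith [h.2]⟩
  have heq : fermiPolarDOS μ θ = fermiPolarDOS μ θ' := by
    have : θ' = θ + (-(toIocDiv Real.two_pi_pos (-π) θ) : ℤ) * (2 * π) := by
      rw [hθ', toIocMod, zsmul_eq_mul]; push_cast; ring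
    rw [this, fermiPolarDOS_add_int_mul_two_pi hμ1 hμ2]
  exact ⟨θ', hmem, heq⟩

/-- **Window-uniform DOS bound**: for `[a, b] ⊆ (−4, 0)` there is `w₁ ≥ 0` with `fermiPolarDOS μ θ ≤ w₁` for all `μ ∈ [a, b]` and ALL `θ`.
[folklore] -/
theorem kl4w_exists_fermiPolarDOS_le_window {a b : ℝ} (ha : -4 < a) (hb : b < 0) :
    ∃ w₁ : ℝ, 0 ≤ w₁ ∧ ∀ μ ∈ Icc a b, ∀ θ : ℝ, fermiPolarDOS μ θ ≤ w₁ := by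
  rcases lt_or_ge b a with hba | hab
  · exact ⟨0, le_rfl, fun μ hμ => absurd (hμ.1.trans hμ.2) (not_le.2 hba)⟩
  obtain ⟨p₀, hp₀, hmax⟩ := kl4w_exists_isMaxOn_fermiPolarDOS ha hb hab
  obtain ⟨hp₀μ, -⟩ := Set.mem_prod.1 hp₀
  have hμ₀1 : -4 < p₀.1 := lt_of_lt_of_le ha hp₀μ.1
  have hμ₀2 : p₀.1 < 0 := lt_of_le_of_lt hp₀μ.2 hb
  refine ⟨fermiPolarDOS p₀.1 p₀.2, le_of_lt (fermiPolarDOS_pos hμ₀1 hμ₀2 p₀.2), fun μ hμ θ => ?_⟩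
  obtain ⟨θ', hmem, heq⟩ := kl4w_fermiPolarDOS_reduce_period ha hb hμ θ
  rw [heq]
  exact (isMaxOn_iff.1 hmax) (μ, θ') (Set.mk_mem_prod hμ hmem)

/-! ### §2 The Minkowski bound with an explicit right-hand side -/

section Polar

variable {μ : ℝ} (hμ₁ : -4 < μ) (hμ₂ : μ < 0)
include hμ₁ hμ₂

/-- `∫_{BZ} ‖F(γθ+γθ', p)‖_{L⁴(dθdθ')} dp ≤ (4C/(4−β))^{1/4} · (vol(BZ) + C_sh/((1−β/4)⁻¹ − 1))` (explicit form of the `< ∞` statement). [folklore] -/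
theorem kl4w_lintegral_eLpNorm_polar_le {C β Csh : ℝ} (hC : 0 ≤ C) (hβ0 : 0 < β) (hβ4 : β < 4) (hCsh : 0 ≤ Csh)
    (hTSL : ∀ (p : Momentum) (s : ℝ), 0 < s →
      ((volume.restrict (Ioc (-π) π)).prod (volume.restrict (Ioc (-π) π)))
        {z : ℝ × ℝ | |squareDispersion 1 0 (p + (fermiPolar μ z.1 + fermiPolar μ z.2)) - μ| < s} ≤
        ENNReal.ofReal (C * s ^ β))
    (hSV : ∀ t : ℝ, 0 < t →
      volume (brillouinZone ∩ {p : Momentum | |squareDispersion 1 0 p - μ| < t}) ≤ ENNReal.ofReal (Csh * t)) :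
    ∫⁻ p in brillouinZone, eLpNorm (fun z : ℝ × ℝ =>
        lindhardIntegrand (squareDispersion 1 0) μ (fermiPolar μ z.1 + fermiPolar μ z.2) p) 4
      ((volume.restrict (Ioc (-π) π)).prod (volume.restrict (Ioc (-π) π))) ≤
      ENNReal.ofReal ((4 * C / (4 - β)) ^ (1 / (4 : ℝ))) *
        (volume brillouinZone + ENNReal.ofReal (Csh * ((1 - β / 4)⁻¹ - 1)⁻¹)) := by
  set ν : Measure (ℝ × ℝ) := (volume.restrict (Ioc (-π) π)).prod (volume.restrict (Ioc (-π) π)) with hν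
  set P : Measure Momentum := volume.restrict brillouinZone with hP
  set K : ℝ := (4 * C / (4 - β)) ^ (1 / (4 : ℝ)) with hK
  have hae : ∀ᵐ p ∂P, eLpNorm (fun z : ℝ × ℝ =>
      lindhardIntegrand (squareDispersion 1 0) μ (fermiPolar μ z.1 + fermiPolar μ z.2) p) 4 ν ≤
      ENNReal.ofReal (K * |squareDispersion 1 0 p - μ| ^ (β / 4 - 1)) := by
    have hnull : ∀ᵐ p ∂P, squareDispersion 1 0 p ≠ μ := by
      rw [hP]
      refine ae_restrict_of_ae ?_
      rw [ae_iff]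
      simp only [not_not]
      exact volume_levelSet_squareDispersion μ
    filter_upwards [hnull] with p hp
    exact kl4_eLpNorm_lindhardIntegrand_polar_le hμ₁ hμ₂ p hC hβ4 (hTSL p) hp
  have hK0 : 0 ≤ K := Real.rpow_nonneg (div_nonneg (by positivity) (by linarith)) _
  have hrw : ∀ p, ENNReal.ofReal (K * |squareDispersion 1 0 p - μ| ^ (β / 4 - 1)) =
      ENNReal.ofReal K * ENNReal.ofReal (|squareDispersion 1 0 p - μ| ^ (-(1 - β / 4))) := fun p => by
    rw [← ENNReal.ofReal_mul hK0]
    congr 2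
    rw [show -(1 - β / 4) = β / 4 - 1 by ring]
  calc ∫⁻ p in brillouinZone, eLpNorm (fun z : ℝ × ℝ =>
        lindhardIntegrand (squareDispersion 1 0) μ (fermiPolar μ z.1 + fermiPolar μ z.2) p) 4 ν
      ≤ ∫⁻ p, ENNReal.ofReal (K * |squareDispersion 1 0 p - μ| ^ (β / 4 - 1)) ∂P := lintegral_mono_ae hae
    _ = ENNReal.ofReal K * ∫⁻ p in brillouinZone, ENNReal.ofReal (|squareDispersion 1 0 p - μ| ^ (-(1 - β / 4))) := by
        simp_rw [hrw]
        rw [lintegral_const_mul _ (by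
          have hε : Continuous (squareDispersion 1 0) := by unfold squareDispersion; fun_prop
          exact ENNReal.measurable_ofReal.comp (((hε.sub continuous_const).abs.measurable).pow_const _))]
    _ ≤ ENNReal.ofReal K * (volume brillouinZone + ENNReal.ofReal (Csh * ((1 - β / 4)⁻¹ - 1)⁻¹)) :=
        mul_le_mul_right (lintegral_rpow_neg_energy_le (γ := 1 - β / 4) (by linarith) (by linarith) hCsh hSV) _

/-- **Explicit `L⁴` bound of the polar kernel**: `‖χ₀(γθ + γθ')‖_{L⁴(dθdθ')} ≤ (2π)⁻² · (4C/(4−β))^{1/4} · (vol(BZ) + C_sh/((1−β/4)⁻¹ − 1))`.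
[cite: SteinSingularIntegrals1970, App. A.1] -/
theorem kl4w_eLpNorm_lindhardKernelPolar_le {C β Csh : ℝ} (hC : 0 ≤ C) (hβ0 : 0 < β) (hβ4 : β < 4) (hCsh : 0 ≤ Csh)
    (hTSL : ∀ (p : Momentum) (s : ℝ), 0 < s →
      ((volume.restrict (Ioc (-π) π)).prod (volume.restrict (Ioc (-π) π)))
        {z : ℝ × ℝ | |squareDispersion 1 0 (p + (fermiPolar μ z.1 + fermiPolar μ z.2)) - μ| < s} ≤
        ENNReal.ofReal (C * s ^ β))
    (hSV : ∀ t : ℝ, 0 < t →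
      volume (brillouinZone ∩ {p : Momentum | |squareDispersion 1 0 p - μ| < t}) ≤ ENNReal.ofReal (Csh * t)) :
    eLpNorm (fun z : ℝ × ℝ => lindhardFunction (squareDispersion 1 0) μ (fermiPolar μ z.1 + fermiPolar μ z.2)) 4
        ((volume.restrict (Ioc (-π) π)).prod (volume.restrict (Ioc (-π) π))) ≤
      ENNReal.ofReal (((2 * π) ^ 2)⁻¹) * (ENNReal.ofReal ((4 * C / (4 - β)) ^ (1 / (4 : ℝ))) *
        (volume brillouinZone + ENNReal.ofReal (Csh * ((1 - β / 4)⁻¹ - 1)⁻¹))) := by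
  set ν : Measure (ℝ × ℝ) := (volume.restrict (Ioc (-π) π)).prod (volume.restrict (Ioc (-π) π)) with hν
  set P : Measure Momentum := volume.restrict brillouinZone with hP
  set g : ℝ × ℝ → ℝ := fun z => ∫ p in brillouinZone,
    lindhardIntegrand (squareDispersion 1 0) μ (fermiPolar μ z.1 + fermiPolar μ z.2) p with hg
  have hMink : eLpNorm g 4 ν ≤ ∫⁻ p, eLpNorm (fun z : ℝ × ℝ =>
      lindhardIntegrand (squareDispersion 1 0) μ (fermiPolar μ z.1 + fermiPolar μ z.2) p) 4 ν ∂P := by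
    have hF : AEStronglyMeasurable (Function.uncurry fun (z : ℝ × ℝ) (p : Momentum) =>
        lindhardIntegrand (squareDispersion 1 0) μ (fermiPolar μ z.1 + fermiPolar μ z.2) p) (ν.prod P) :=
      (measurable_lindhardIntegrand_polar hμ₁ hμ₂).aestronglyMeasurable
    exact Literature.Analysis.FunctionSpaces.eLpNorm_integral_le_lintegral_eLpNorm hF (p := 4)
      (by norm_num) ENNReal.ofNat_ne_top
  have hfun : (fun z : ℝ × ℝ => lindhardFunction (squareDispersion 1 0) μ (fermiPolar μ z.1 + fermiPolar μ z.2)) =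
      ((2 * π) ^ 2)⁻¹ • g := by
    funext z
    simp only [lindhardFunction, hg, Pi.smul_apply, smul_eq_mul]
    rw [div_eq_inv_mul]
  rw [hfun, eLpNorm_const_smul]
  have hc : ‖((2 * π) ^ 2)⁻¹‖ₑ = ENNReal.ofReal (((2 * π) ^ 2)⁻¹) := by
    rw [Real.enorm_eq_ofReal (by positivity)]
  rw [hc]
  exact mul_le_mul_right (hMink.trans (kl4w_lintegral_eLpNorm_polar_le hμ₁ hμ₂ hC hβ0 hβ4 hCsh hTSL hSV)) _

/-! ### §3 Transport with an explicit constant -/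

/-- **`‖χ₀(·+·)‖_{L⁴(σ_μ ⊗ σ_μ)} ≤ (w₁²)^{1/4} · ‖χ₀(γ· + γ·)‖_{L⁴(dθ dθ')}`** whenever `fermiPolarDOS μ ≤ w₁`. [folklore] -/
theorem kl4w_eLpNorm_kernel_le {w₁ : ℝ} (hw : ∀ θ, fermiPolarDOS μ θ ≤ w₁) :
    eLpNorm (fun z : Momentum × Momentum => lindhardFunction (squareDispersion 1 0) μ (z.1 + z.2)) 4
        ((fermiCurveMeasure (squareDispersion 1 0) μ).prod (fermiCurveMeasure (squareDispersion 1 0) μ)) ≤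
      (ENNReal.ofReal w₁ * ENNReal.ofReal w₁) ^ (1 / (4 : ℝ≥0∞)).toReal *
        eLpNorm (fun z : ℝ × ℝ => lindhardFunction (squareDispersion 1 0) μ (fermiPolar μ z.1 + fermiPolar μ z.2)) 4
          ((volume.restrict (Ioc (-π) π)).prod (volume.restrict (Ioc (-π) π))) := by
  have hFm : Measurable (fermiPolar μ) := (continuous_fermiPolar hμ₁ hμ₂).measurable
  have hle := klhs_kernel_fermiCurveMeasure_le hμ₁ hμ₂ hw
  have hfm : Measurable (fun z : Momentum × Momentum => lindhardFunction (squareDispersion 1 0) μ (z.1 + z.2)) :=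
    (measurable_lindhardFunction (measurable_squareDispersion 1 0) μ).comp measurable_add
  have hdom : (fermiCurveMeasure (squareDispersion 1 0) μ).prod (fermiCurveMeasure (squareDispersion 1 0) μ) ≤
      (ENNReal.ofReal w₁ * ENNReal.ofReal w₁) • Measure.map (Prod.map (fermiPolar μ) (fermiPolar μ))
          ((volume.restrict (Ioc (-π) π)).prod (volume.restrict (Ioc (-π) π))) := by
    calc (fermiCurveMeasure (squareDispersion 1 0) μ).prod (fermiCurveMeasure (squareDispersion 1 0) μ)
        ≤ (ENNReal.ofReal w₁ • Measure.map (fermiPolar μ) (volume.restrict (Ioc (-π) π))).prod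
            (ENNReal.ofReal w₁ • Measure.map (fermiPolar μ) (volume.restrict (Ioc (-π) π))) :=
          Measure.prod_mono hle hle
      _ = (ENNReal.ofReal w₁ * ENNReal.ofReal w₁) • Measure.map (Prod.map (fermiPolar μ) (fermiPolar μ))
            ((volume.restrict (Ioc (-π) π)).prod (volume.restrict (Ioc (-π) π))) := by
          rw [Measure.prod_smul_left, Measure.prod_smul_right, Measure.map_prod_map _ _ hFm hFm, smul_smul]
  calc eLpNorm (fun z : Momentum × Momentum => lindhardFunction (squareDispersion 1 0) μ (z.1 + z.2)) 4
        ((fermiCurveMeasure (squareDispersion 1 0) μ).prod (fermiCurveMeasure (squareDispersion 1 0) μ))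
      ≤ eLpNorm (fun z : Momentum × Momentum => lindhardFunction (squareDispersion 1 0) μ (z.1 + z.2)) 4
          ((ENNReal.ofReal w₁ * ENNReal.ofReal w₁) • Measure.map (Prod.map (fermiPolar μ) (fermiPolar μ))
            ((volume.restrict (Ioc (-π) π)).prod (volume.restrict (Ioc (-π) π)))) := eLpNorm_mono_measure _ hdom
    _ = (ENNReal.ofReal w₁ * ENNReal.ofReal w₁) ^ (1 / (4 : ℝ≥0∞)).toReal *
          eLpNorm (fun z : Momentum × Momentum => lindhardFunction (squareDispersion 1 0) μ (z.1 + z.2)) 4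
            (Measure.map (Prod.map (fermiPolar μ) (fermiPolar μ))
              ((volume.restrict (Ioc (-π) π)).prod (volume.restrict (Ioc (-π) π)))) := by
        rw [eLpNorm_smul_measure_of_ne_top ENNReal.ofNat_ne_top, smul_eq_mul]
    _ = (ENNReal.ofReal w₁ * ENNReal.ofReal w₁) ^ (1 / (4 : ℝ≥0∞)).toReal *
          eLpNorm (fun z : ℝ × ℝ => lindhardFunction (squareDispersion 1 0) μ (fermiPolar μ z.1 + fermiPolar μ z.2)) 4
            ((volume.restrict (Ioc (-π) π)).prod (volume.restrict (Ioc (-π) π))) := by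
        rw [eLpNorm_map_measure hfm.aestronglyMeasurable (hFm.prodMap hFm).aemeasurable]
        rfl

end Polar

/-! ### §4 The `ChainHS` slot at one level `μ ∈ (−4, 0)` -/

section Slot

variable {μ : ℝ} (hμ₁ : -4 < μ) (hμ₂ : μ < 0)
include hμ₁ hμ₂

/-- **`∃ H ≥ 0, ChainHS 0 μ μ H`** at every `μ ∈ (−4, 0)`: the chain-kernel Hilbert–Schmidt enclosure slot of `…KlThirdOrderFormBoundOfHS` holds
with SOME constant (its `L²(σ_μ ⊗ σ_μ)` norm) — qualitative, per level, no number. [folklore] -/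
theorem kl4_exists_chainHS : ∃ H : ℝ, 0 ≤ H ∧ KlThirdOrder.ChainHS 0 μ μ H := by
  refine ⟨Real.sqrt (∫ z, (chainKernel3 (squareDispersion 1 0) μ z.1 z.2) ^ 2
      ∂(fermiCurveMeasure (squareDispersion 1 0) μ).prod (fermiCurveMeasure (squareDispersion 1 0) μ)),
    Real.sqrt_nonneg _, ?_⟩
  intro ν hν
  have hνμ : ν = μ := le_antisymm hν.2 hν.1
  subst hνμ
  exact ⟨kl4_chainKernel_memLp_two hμ₁ hμ₂, le_rfl⟩

/-- **At `t′ = 0` the third-order form bound needs ONLY a two-loop Hilbert–Schmidt enclosure**: for `μ ∈ (−4, 0)` and any `T` with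
`TwoLoopHS 0 μ μ T` there is `H ≥ 0` with `FormBound 0 μ μ (H + T)` — hence (✓ p732729) `KLChannelRemainderBound 0 μ μ (klLambda3 0) (H + T) U₁`
and strict third-order `B1g` selection below `klU0 γ (H + T) 1` wherever a certified margin `KLB1gDominatesTP 0 μ μ γ` holds. [folklore] -/
theorem kl4_formBound_of_twoLoopHS {T : ℝ} (hT : KlThirdOrder.TwoLoopHS 0 μ μ T) :
    ∃ H : ℝ, 0 ≤ H ∧ KlThirdOrder.FormBound 0 μ μ (H + T) := by
  obtain ⟨H, hH, hC⟩ := kl4_exists_chainHS hμ₁ hμ₂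
  exact ⟨H, hH, klFormBound_zero_of_HS hμ₁ hμ₂ hC hT⟩

/-- The same with the remainder slot spelled out: `TwoLoopHS 0 μ μ T`, `0 ≤ T` ⇒ `∃ M ≥ T`, `KLChannelRemainderBound 0 μ μ (klLambda3 0) M U₁`
for every `U₁`. [folklore] -/
theorem kl4_channelRemainderBound_of_twoLoopHS {T : ℝ} (hT0 : 0 ≤ T) (hT : KlThirdOrder.TwoLoopHS 0 μ μ T) (U₁ : ℝ) :
    ∃ M : ℝ, T ≤ M ∧ KLChannelRemainderBound 0 μ μ (klLambda3 0) M U₁ := by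
  obtain ⟨H, hH, hF⟩ := kl4_formBound_of_twoLoopHS hμ₁ hμ₂ hT
  exact ⟨H + T, by linarith, klChannelRemainderBound_lambda3 (by linarith) hF U₁⟩

end Slot

/-! ### §5 The window-uniform `ChainHS` -/

/-- `‖f²‖_{L²} = ‖f‖_{L⁴}²` for a real function. [folklore] -/
theorem kl4w_eLpNorm_sq_two {α : Type*} [MeasurableSpace α] {ν : Measure α} (f : α → ℝ) :
    eLpNorm (fun x => f x ^ 2) 2 ν = eLpNorm f 4 ν ^ (2 : ℝ) := by
  have h := eLpNorm_norm_rpow f (p := 2) (μ := ν) (q := 2) two_pos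
  have e : (fun x => ‖f x‖ ^ (2 : ℝ)) = fun x => f x ^ 2 := by
    funext x; rw [Real.norm_eq_abs, Real.rpow_two, sq_abs]
  rw [e] at h
  rw [h, show (2 : ℝ≥0∞) * ENNReal.ofReal 2 = 4 by rw [ENNReal.ofReal_ofNat]; norm_num]

/-- **Window-uniform chain-kernel Hilbert–Schmidt bound**: for `[a, b] ⊆ (−4, 0)` there is `H ≥ 0` with `KlThirdOrder.ChainHS 0 a b H`.
[cite: SteinSingularIntegrals1970, App. A.1] -/
theorem kl4w_exists_chainHS_window {a b : ℝ} (ha : -4 < a) (hb : b < 0) :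
    ∃ H : ℝ, 0 ≤ H ∧ KlThirdOrder.ChainHS 0 a b H := by
  obtain ⟨C, β, hC, hβ0, hβ2, hTSL⟩ := exists_torusSublevel_le (μ₁ := a) (μ₂ := b) ha hb
  obtain ⟨Csh, hCsh, hSV⟩ := exists_shellVolume_le (μ₁ := a) (μ₂ := b) ha hb
  obtain ⟨w₁, hw0, hw⟩ := kl4w_exists_fermiPolarDOS_le_window ha hb
  -- the uniform `L⁴` bound of `χ₀(k + k')` on `σ_μ ⊗ σ_μ`, `μ ∈ [a, b]`
  set B : ℝ≥0∞ := (ENNReal.ofReal w₁ * ENNReal.ofReal w₁) ^ (1 / (4 : ℝ≥0∞)).toReal *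
    (ENNReal.ofReal (((2 * π) ^ 2)⁻¹) * (ENNReal.ofReal ((4 * C / (4 - β)) ^ (1 / (4 : ℝ))) *
      (volume brillouinZone + ENNReal.ofReal (Csh * ((1 - β / 4)⁻¹ - 1)⁻¹)))) with hB
  have hBtop : B ≠ ⊤ := by
    refine ENNReal.mul_ne_top (ENNReal.rpow_ne_top_of_nonneg (by positivity)
      (ENNReal.mul_ne_top ENNReal.ofReal_ne_top ENNReal.ofReal_ne_top)) ?_
    exact ENNReal.mul_ne_top ENNReal.ofReal_ne_top (ENNReal.mul_ne_top ENNReal.ofReal_ne_top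
      (ENNReal.add_ne_top.2 ⟨volume_brillouinZone_lt_top.ne, ENNReal.ofReal_ne_top⟩))
  have hker : ∀ μ ∈ Icc a b, eLpNorm (fun z : Momentum × Momentum => lindhardFunction (squareDispersion 1 0) μ (z.1 + z.2)) 4
      ((fermiCurveMeasure (squareDispersion 1 0) μ).prod (fermiCurveMeasure (squareDispersion 1 0) μ)) ≤ B := by
    intro μ hμ
    have hμ₁ : -4 < μ := lt_of_lt_of_le ha hμ.1
    have hμ₂ : μ < 0 := lt_of_le_of_lt hμ.2 hb
    exact (kl4w_eLpNorm_kernel_le hμ₁ hμ₂ (hw μ hμ)).trans (mul_le_mul_right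
      (kl4w_eLpNorm_lindhardKernelPolar_le hμ₁ hμ₂ hC hβ0 (by linarith) hCsh (hTSL μ hμ) (hSV μ hμ)) _)
  -- the chain kernel: `‖χ₀(k−k')² + χ₀(k+k')²‖₂ ≤ 2 B²`
  refine ⟨(B ^ (2 : ℝ) + B ^ (2 : ℝ)).toReal, ENNReal.toReal_nonneg, fun μ hμ => ?_⟩
  have hμ₁ : -4 < μ := lt_of_lt_of_le ha hμ.1
  have hμ₂ : μ < 0 := lt_of_le_of_lt hμ.2 hb
  haveI : IsFiniteMeasure (fermiCurveMeasure (squareDispersion 1 0) μ) :=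
    stub_klFiniteMeasure stub_klGradient stub_klHausdorffFinite μ ⟨hμ₁, hμ₂⟩
  refine ⟨kl4_chainKernel_memLp_two hμ₁ hμ₂, ?_⟩
  set σ := fermiCurveMeasure (squareDispersion 1 0) μ with hσ
  set fp : Momentum × Momentum → ℝ := fun z => lindhardFunction (squareDispersion 1 0) μ (z.1 + z.2) with hfp
  set fm : Momentum × Momentum → ℝ := fun z => lindhardFunction (squareDispersion 1 0) μ (z.1 - z.2) with hfm
  -- `‖fm‖₄ = ‖fp‖₄` by inversion invariance
  have hT : MeasurePreserving (Prod.map (id : Momentum → Momentum) (fun k : Momentum => -k)) (σ.prod σ) (σ.prod σ) :=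
    (MeasurePreserving.id _).prod (kl4_neg_measurePreserving hμ₂)
  have hfpm : Measurable fp := (measurable_lindhardFunction (measurable_squareDispersion 1 0) μ).comp measurable_add
  have hfm_eq : eLpNorm fm 4 (σ.prod σ) = eLpNorm fp 4 (σ.prod σ) := by
    have e : fm = fp ∘ Prod.map (id : Momentum → Momentum) (fun k : Momentum => -k) := by
      funext z; simp [hfm, hfp, sub_eq_add_neg]
    rw [e, ← eLpNorm_map_measure (hfpm.aestronglyMeasurable) hT.measurable.aemeasurable, hT.map_eq]
  -- triangle inequality in `L²`
  have hchain : (fun z : Momentum × Momentum => chainKernel3 (squareDispersion 1 0) μ z.1 z.2) =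
      (fun z => fm z ^ 2) + fun z => fp z ^ 2 := by
    funext z; simp [chainKernel3, hfm, hfp]
  have h2 : eLpNorm (fun z : Momentum × Momentum => chainKernel3 (squareDispersion 1 0) μ z.1 z.2) 2 (σ.prod σ) ≤
      B ^ (2 : ℝ) + B ^ (2 : ℝ) := by
    rw [hchain]
    have hm4 : MemLp fm 4 (σ.prod σ) := kl4_kernel_sub_memLp hμ₁ hμ₂
    have hp4 : MemLp fp 4 (σ.prod σ) := kl4_kernel_memLp hμ₁ hμ₂
    have hm2 : AEStronglyMeasurable (fun z => fm z ^ 2) (σ.prod σ) := hm4.1.pow 2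
    have hp2 : AEStronglyMeasurable (fun z => fp z ^ 2) (σ.prod σ) := hp4.1.pow 2
    refine (eLpNorm_add_le hm2 hp2 (by norm_num)).trans ?_
    rw [kl4w_eLpNorm_sq_two, kl4w_eLpNorm_sq_two, hfm_eq]
    have hb : eLpNorm fp 4 (σ.prod σ) ^ (2 : ℝ) ≤ B ^ (2 : ℝ) := ENNReal.rpow_le_rpow (hker μ hμ) (by norm_num)
    exact add_le_add hb hb
  -- `√(∫ chain²) = ‖chain‖₂.toReal ≤ (B² + B²).toReal`
  rw [integral_sq_eq_toReal_eLpNorm_sq (kl4_chainKernel_memLp_two hμ₁ hμ₂), Real.sqrt_sq ENNReal.toReal_nonneg]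
  exact ENNReal.toReal_mono (ENNReal.add_ne_top.2 ⟨ENNReal.rpow_ne_top_of_nonneg (by norm_num) hBtop,
    ENNReal.rpow_ne_top_of_nonneg (by norm_num) hBtop⟩) h2

/-- **On any window `[a, b] ⊆ (−4, 0)` the third-order form bound needs only a two-loop HS enclosure**:
`∃ H ≥ 0, ∀ T, TwoLoopHS 0 a b T → FormBound 0 a b (H + T)`. [folklore] -/
theorem kl4w_formBound_window_of_twoLoopHS {a b : ℝ} (ha : -4 < a) (hb : b < 0) :
    ∃ H : ℝ, 0 ≤ H ∧ ∀ T : ℝ, KlThirdOrder.TwoLoopHS 0 a b T → KlThirdOrder.FormBound 0 a b (H + T) := by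
  obtain ⟨H, hH, hC⟩ := kl4w_exists_chainHS_window ha hb
  exact ⟨H, hH, fun T hT => klFormBound_zero_of_HS ha hb hC hT⟩

/-- **Doping window `δ ∈ [0.10, 0.20]`: third-order `B1g` selection from the records' enclosures and a TWO-LOOP HS enclosure alone.**
There is `H ≥ 0` (the chain kernel's uniform HS bound on `μ ∈ [−0.42749, −0.1775]`, a theorem) such that for every `T ≥ 0` with
`TwoLoopHS 0 (−0.42749) (−0.1775) T`, every `μ` of the window, every `0 < U < klU0 (437/16384) (H + T) 1` and every `χ ≠ B1g`:
`channelInf3 ε₀ μ U B1g < channelInf3 ε₀ μ U χ` (modulo `klCertB1gWin{A,B,C}.EnclosuresB1g`). [cite: RaghuKivelsonScalapino2010, §III Fig. 2, §IV] -/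
theorem kl4w_channelInf3_B1g_lt_window_d010_d020_of_twoLoopHS :
    ∃ H : ℝ, 0 ≤ H ∧ ∀ (hA : klCertB1gWinA.EnclosuresB1g) (hB : klCertB1gWinB.EnclosuresB1g) (hC : klCertB1gWinC.EnclosuresB1g)
      {T : ℝ}, 0 ≤ T → KlThirdOrder.TwoLoopHS 0 (-0.42749) (-0.1775) T →
      ∀ {μ : ℝ}, μ ∈ Set.Icc (-0.42749 : ℝ) (-0.1775) → ∀ {U : ℝ}, 0 < U → U < klU0 (437 / 16384) (H + T) 1 →
      ∀ {χ : D4Irrep}, χ ≠ D4Irrep.B1g →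
        channelInf3 (squareDispersion 1 0) μ U D4Irrep.B1g < channelInf3 (squareDispersion 1 0) μ U χ := by
  obtain ⟨H, hH, hC⟩ := kl4w_exists_chainHS_window (a := -0.42749) (b := -0.1775) (by norm_num) (by norm_num)
  refine ⟨H, hH, fun hA hB hC' T hT0 hT μ hμ U hU0 hU χ hχ => ?_⟩
  exact klChannelInf3_B1g_lt_window_d010_d020_of_HS hA hB hC' (add_nonneg hH hT0) hC hT hμ hU0 hU hχ

end Summit.HubbardSuperconductivity.HubbardSuperconductivity.Theorems

end
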